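import Mathlib
import Literature.NumberTheory.Transcendental.KZHyperbolicLadder
import Literature.NumberTheory.Transcendental.KZCalculusProofs
import Literature.NumberTheory.Transcendental.SemialgebraicMapsProofs
import Literature.NumberTheory.Transcendental.KZSemialgebraicComplex
import Literature.NumberTheory.Transcendental.KZIdealTetrahedron
import Summits.KontsevichZagierPeriods.KontsevichZagierPeriods.Theorems.HyperbolicBlochOffTetraSectorKernelStubSimilarityMove

/-!
# Stub `exists_isLadderFamily` — crux `OffTetraSectorKernel`, line `odd-hyperbolic-ladder`

Non-vacuity of every rung of Goncharov's hyperbolic scissors ladder inside Kontsevich–Zagier's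
calculus of moves: an ADMISSIBLE LADDER FAMILY exists at every rung `n`, i.e. every `ℚ̄`-geodesic
polytope `P` of `ℍⁿ⁺¹` (upper half-space model `ℝⁿ × ℝ₊`, coordinates `p : Fin (n + 1) → ℝ`, height
`t = p (Fin.last n)`) carries a Kontsevich–Zagier integral representation `[P, t^{-(n+1)}]`
(`KZ.IsLadderFamily n ρ`).

The three data of the representation:
* the domain `P` is `ℚ`-semialgebraic (`isSemialgebraic_of_isGeodesicPolytope`): it is cut out of
  the open upper half-space by finitely many strict inequalities `0 < ε · g` where `g` is either
  affine `Σ aₗ pₗ − c` or quadratic `Σ (pₗ − aₗ)² − c` with REAL ALGEBRAIC coefficients; real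
  algebraic constants are `ℚ`-definable (`isSemialgebraicFunOn_const_of_isAlgebraic`, Kontsevich–Zagier
  allow "algebraic" for "rational"), and `ℚ`-semialgebraic functions are closed under sums, products
  and differences (Tarski–Seidenberg, Bochnak–Coste–Roy Prop. 2.2.6), so each `{0 < ε · g}` is
  `ℚ`-semialgebraic and so is their finite intersection;
* the density `t^{-(n+1)} = 1 / X_last^{n+1}` is a quotient of `ℚ`-polynomials with denominator
  non-vanishing on `P ⊆ {t > 0}` (`isSemialgebraicFunOn_hypDensity_of_subset_upperHalfSpace`);
* integrability of `t^{-(n+1)}` on `P` (finite volume) is part of the definition of a polytope.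
The family is then `ρ P := [P, t^{-(n+1)}]` on polytopes and the empty representation elsewhere.

References: A. B. Goncharov, *Volumes of hyperbolic manifolds and mixed Tate motives* (1999), §1.1;
M. Kontsevich, D. Zagier, *Periods* (2001), §1.1; J. Bochnak, M. Coste, M.-F. Roy,
*Real Algebraic Geometry* (1998), §2.2.
-/

noncomputable section

open Set MeasureTheory MvPolynomial
open Literature.NumberTheory.Transcendental Literature.ModelTheory.ExponentialFields

namespace Summit.KontsevichZagierPeriods.HyperbolicBloch.OffTetraSectorKernel

/-- A case distinction on a Boolean flag between two `ℚ`-semialgebraic functions is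
`ℚ`-semialgebraic (it is one of the two). [folklore] -/
theorem isSemialgebraicFunOn_ite_bool {m : ℕ} {s : Set (Fin m → ℝ)} (b : Bool)
    {f g : (Fin m → ℝ) → ℝ} (hf : IsSemialgebraicFunOn ℚ s f) (hg : IsSemialgebraicFunOn ℚ s g) :
    IsSemialgebraicFunOn ℚ s (fun p => if b then f p else g p) := by
  cases b
  · simpa using hg
  · simpa using hf

/-- The coordinate functions `p ↦ p l` are `ℚ`-semialgebraic on `ℝᵐ`. [cite: BochnakCosteRoy1998, §2.2] -/
theorem isSemialgebraicFunOn_apply_univ {m : ℕ} (l : Fin m) :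
    IsSemialgebraicFunOn ℚ (univ : Set (Fin m → ℝ)) (fun p => p l) :=
  (isSemialgebraicFunOn_aeval isSemialgebraic_univ (X l)).congr fun p _ => by simp

/-- An affine function `p ↦ Σₗ aₗ pₗ − c` with real algebraic coefficients is `ℚ`-semialgebraic on
`ℝᵐ` (algebraic constants are `ℚ`-definable; closure under sums and products, Tarski–Seidenberg).
[cite: BochnakCosteRoy1998, Prop. 2.2.6] -/
theorem isSemialgebraicFunOn_affine_of_isAlgebraic {m : ℕ} {a : Fin m → ℝ} {c : ℝ}
    (ha : ∀ l, IsAlgebraic ℚ (a l)) (hc : IsAlgebraic ℚ c) :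
    IsSemialgebraicFunOn ℚ (univ : Set (Fin m → ℝ)) (fun p => (∑ l, a l * p l) - c) := by
  have hU : IsSemialgebraic ℚ (univ : Set (Fin m → ℝ)) := isSemialgebraic_univ
  exact IsSemialgebraicFunOn.sub_holds
    (isSemialgebraicFunOn_finset_sum hU Finset.univ fun l _ =>
      (IsSemialgebraicFunOn.mul_holds (isSemialgebraicFunOn_const_of_isAlgebraic hU (ha l))
        (isSemialgebraicFunOn_apply_univ l)).congr fun p _ => rfl)
    (isSemialgebraicFunOn_const_of_isAlgebraic hU hc)

/-- A sphere function `p ↦ Σₗ (pₗ − aₗ)² − c` with real algebraic centre and radius data is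
`ℚ`-semialgebraic on `ℝᵐ` (algebraic constants are `ℚ`-definable; closure under sums, differences
and products, Tarski–Seidenberg). [cite: BochnakCosteRoy1998, Prop. 2.2.6] -/
theorem isSemialgebraicFunOn_sphere_of_isAlgebraic {m : ℕ} {a : Fin m → ℝ} {c : ℝ}
    (ha : ∀ l, IsAlgebraic ℚ (a l)) (hc : IsAlgebraic ℚ c) :
    IsSemialgebraicFunOn ℚ (univ : Set (Fin m → ℝ)) (fun p => (∑ l, (p l - a l) ^ 2) - c) := by
  have hU : IsSemialgebraic ℚ (univ : Set (Fin m → ℝ)) := isSemialgebraic_univ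
  refine IsSemialgebraicFunOn.sub_holds
    (isSemialgebraicFunOn_finset_sum hU Finset.univ fun l _ => ?_)
    (isSemialgebraicFunOn_const_of_isAlgebraic hU hc)
  have h1 : IsSemialgebraicFunOn ℚ (univ : Set (Fin m → ℝ)) (fun p => p l - a l) :=
    IsSemialgebraicFunOn.sub_holds (isSemialgebraicFunOn_apply_univ l)
      (isSemialgebraicFunOn_const_of_isAlgebraic hU (ha l))
  exact (IsSemialgebraicFunOn.mul_holds h1 h1).congr fun p _ => by
    simp only [Pi.mul_apply, sq]

/-- **Key lemma.** A `ℚ̄`-geodesic polytope of `ℍⁿ⁺¹` is a `ℚ`-semialgebraic subset of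
`ℝⁿ × ℝ₊`: it is the intersection of the open upper half-space `{0 < t}` with finitely many sets
`{0 < ε · g}`, `g` affine or a sphere function with real algebraic coefficients, each of which is
`ℚ`-semialgebraic (Kontsevich–Zagier: "rational" may be replaced by "algebraic").
[cite: KontsevichZagier2001, §1.1] -/
theorem isSemialgebraic_of_isGeodesicPolytope {n : ℕ} {P : Set (Fin (n + 1) → ℝ)}
    (hP : KZ.IsGeodesicPolytope n P) : IsSemialgebraic ℚ P := by
  obtain ⟨k, flat, a, c, ε, ha, hc, hε, -, rfl, -⟩ := hP
  have hU : IsSemialgebraic ℚ (univ : Set (Fin (n + 1) → ℝ)) := isSemialgebraic_univ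
  have h0 : IsSemialgebraicFunOn ℚ (univ : Set (Fin (n + 1) → ℝ)) (fun _ => (0 : ℝ)) :=
    isSemialgebraicFunOn_const_of_isAlgebraic hU isAlgebraic_zero
  have hεalg : ∀ i, IsAlgebraic ℚ (ε i) := fun i => by
    rcases hε i with h | h <;> rw [h]
    · exact isAlgebraic_one
    · exact isAlgebraic_one.neg
  -- the defining functions of the half-spaces are `ℚ`-semialgebraic
  have hg : ∀ i, IsSemialgebraicFunOn ℚ (univ : Set (Fin (n + 1) → ℝ)) (fun p => ε i *
      (if flat i then (∑ l, a i l * p l) - c i else (∑ l, (p l - a i l) ^ 2) - c i)) := fun i =>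
    IsSemialgebraicFunOn.mul_holds (isSemialgebraicFunOn_const_of_isAlgebraic hU (hεalg i))
      (isSemialgebraicFunOn_ite_bool (flat i)
        (isSemialgebraicFunOn_affine_of_isAlgebraic (ha i) (hc i))
        (isSemialgebraicFunOn_sphere_of_isAlgebraic (ha i) (hc i)))
  -- the pieces
  have S0 : IsSemialgebraic ℚ {p : Fin (n + 1) → ℝ | 0 < p (Fin.last n)} :=
    isSemialgebraic_setOf_lt_of_isSemialgebraicFunOn h0 (isSemialgebraicFunOn_apply_univ _)
  have S : ∀ i, IsSemialgebraic ℚ {p : Fin (n + 1) → ℝ | 0 < ε i *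
      (if flat i then (∑ l, a i l * p l) - c i else (∑ l, (p l - a i l) ^ 2) - c i)} := fun i =>
    isSemialgebraic_setOf_lt_of_isSemialgebraicFunOn h0 (hg i)
  convert S0.inter (IsSemialgebraic.biInter Finset.univ _ fun i _ => S i) using 1
  ext p
  simp

/-- A `ℚ̄`-geodesic polytope of `ℍⁿ⁺¹` lies in the open upper half-space `{0 < t}`.
[cite: Goncharov1999, §1.1] -/
theorem subset_upperHalfSpace_of_isGeodesicPolytope {n : ℕ} {P : Set (Fin (n + 1) → ℝ)}
    (hP : KZ.IsGeodesicPolytope n P) : P ⊆ KZ.upperHalfSpace n := by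
  obtain ⟨k, flat, a, c, ε, -, -, -, -, rfl, -⟩ := hP
  exact fun p hp => hp.1

/-- A `ℚ̄`-geodesic polytope of `ℍⁿ⁺¹` has finite volume: `t^{-(n+1)}` is integrable on it (part of
the definition). [cite: Goncharov1999, §1.1] -/
theorem integrableOn_hypDensity_of_isGeodesicPolytope {n : ℕ} {P : Set (Fin (n + 1) → ℝ)}
    (hP : KZ.IsGeodesicPolytope n P) : IntegrableOn (KZ.hypDensity n) P := by
  obtain ⟨k, flat, a, c, ε, -, -, -, -, -, h⟩ := hP
  exact h

/-- The hyperbolic volume density `t^{-(n+1)} = 1 / X_last^{n+1}` is a `ℚ`-semialgebraic function on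
every `ℚ`-semialgebraic subset of the open upper half-space (a quotient of rational polynomials with
non-vanishing denominator). [cite: KontsevichZagier2001, §1.1] -/
theorem isSemialgebraicFunOn_hypDensity_of_subset_upperHalfSpace {n : ℕ} {s : Set (Fin (n + 1) → ℝ)}
    (hs : IsSemialgebraic ℚ s) (h : s ⊆ KZ.upperHalfSpace n) :
    IsSemialgebraicFunOn ℚ s (KZ.hypDensity n) := by
  have hq : ∀ p ∈ s, aeval p (X (Fin.last n) ^ (n + 1) : MvPolynomial (Fin (n + 1)) ℚ) ≠ 0 :=
    fun p hp => by
      have h2 : (0 : ℝ) < p (Fin.last n) := h hp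
      simpa using pow_ne_zero (n + 1) h2.ne'
  exact (isSemialgebraicFunOn_aeval_div_aeval hs 1 (X (Fin.last n) ^ (n + 1)) hq).congr
    fun p _ => by simp [KZ.hypDensity]

/-- The Kontsevich–Zagier integral representation `[P, t^{-(n+1)}]` of the hyperbolic volume of a
`ℚ̄`-geodesic polytope `P` of `ℍⁿ⁺¹`. [cite: KontsevichZagier2001, §1.1] -/
def geodesicPolytopeRep {n : ℕ} {P : Set (Fin (n + 1) → ℝ)} (hP : KZ.IsGeodesicPolytope n P) :
    KZ.IntegralRep (n + 1) where
  domain := P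
  integrand := KZ.hypDensity n
  isSemialgebraic_domain := isSemialgebraic_of_isGeodesicPolytope hP
  isSemialgebraicFunOn_integrand :=
    isSemialgebraicFunOn_hypDensity_of_subset_upperHalfSpace (isSemialgebraic_of_isGeodesicPolytope hP)
      (subset_upperHalfSpace_of_isGeodesicPolytope hP)
  integrableOn := integrableOn_hypDensity_of_isGeodesicPolytope hP

/-- **An admissible ladder family exists at every rung.** Every `ℚ̄`-geodesic polytope `P` of
`ℍⁿ⁺¹` carries the Kontsevich–Zagier integral representation `[P, t^{-(n+1)}]`; choosing it on
polytopes (and the empty representation elsewhere) is an admissible ladder family.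
[cite: KontsevichZagier2001, §1.1] -/
theorem exists_isLadderFamily : ∀ n : ℕ, ∃ ρ : Set (Fin (n + 1) → ℝ) → Literature.NumberTheory.Transcendental.KZ.IntegralRep (n + 1), Literature.NumberTheory.Transcendental.KZ.IsLadderFamily n ρ := by
  classical
  intro n
  refine ⟨fun P => if h : KZ.IsGeodesicPolytope n P then geodesicPolytopeRep h
    else KZ.IntegralRep.empty (n + 1), fun P hP => ?_⟩
  simp only [dif_pos hP]
  exact ⟨rfl, fun _ _ => rfl⟩

end Summit.KontsevichZagierPeriods.HyperbolicBloch.OffTetraSectorKernel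

end
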